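import Literature.AlgebraicGeometry.HodgeTheory.ChernCharacterLawsCoherent
import Literature.AlgebraicGeometry.HodgeTheory.ThomGysinClosedImmersion
import Literature.AlgebraicGeometry.HodgeTheory.AffineLineBundleCohomology
import Literature.AlgebraicGeometry.ModuliOfSheaves.LangerBoundedness
import Literature.AlgebraicGeometry.Modules.PullbackStalk
import Literature.AlgebraicGeometry.Modules.IdealSheafOfClosedImmersion
import HarnessLib

/-!
# The SHAPE of the leading term of Riemann–Roch for a sheaf supported on a smooth subvariety, for every lawful Chern datum:
# `ch_k(F) = 0` below the codimension and `ch_r(F) ∈ ℂ · i_* 1_V` in the codimension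

Family `hodge`, layer `Literature/AlgebraicGeometry/HodgeTheory`. HONEST FRAMING: nothing here constructs a Chern character or
bears on any case of the Hodge conjecture; `ChernCharacterBetti` stays a hypothesis structure without an instance, and the VALUE of
the leading coefficient (Grothendieck–Riemann–Roch ∕ «Riemann–Roch without denominators»: `c_r(i_*𝒪_V) = (−1)^{r−1}(r−1)! [V]`,
Fulton Thm. 15.2, §15.3, Example 15.3.1) is NOT proved here. Sequel to `HodgeTheory/ChernCharacterLawsCoherent` (the Chern character
`ChernDatum.chKZeroCoh` of an additive raw datum on Hartshorne's `K(X)` of a smooth projective `X`).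

For `X` smooth projective over `ℂ` of dimension `n`, a closed immersion `i : V ⟶ X` from a smooth projective `V` of dimension `m`
(`n = m + r`), a coherent sheaf `F` on `X` SUPPORTED ON `i(V)` (its inverse image on every open `W ⊆ X ∖ i(V)` vanishes — e.g.
`F = i_*𝒪_V`), and a raw datum `ch` that is additive on short exact sequences of vector bundles and functorial along `ℂ`-morphisms
(two of the nine topological laws `ChernDatum.IsTopological`):

* §1 (`K`-theory, any schemes) `KTheory.KZero.map_ofCoh_eq_zero_of_isZero_pullback` — **along a FLAT `u : U ⟶ X` with `u^*F = 0` the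
  class `[F]_{ℰ•} ∈ K₀(X)` pulls back to `0 ∈ K₀(U)`**: `u^*ℰ•` is an acyclic bounded complex of vector bundles (`u^*` is exact, so
  `u^*ℰ• → u^*F[0] = 0` is still a quasi-isomorphism) and acyclic complexes have Euler characteristic `0`
  (`KTheory.IsBoundedVBComplex.eulerChar_eq_zero_of_acyclic`).
* §2 `ChernDatum.map_chKZeroCoh_eq_zero_of_isZero_pullback`, `ChernDatum.restrictCompl_chKZeroCoh_eq_zero` — hence **`ch_k(F)` restricts
  to `0` on `(X ∖ i(V))(ℂ)`** (functoriality of `ch` along the open immersion `X ∖ i(V) ↪ X`; the topological restriction is the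
  pull-back along it, `restrictCompl_eq_zero_of_map_eq_zero`).
* §3 by the tree's UNCONDITIONAL Thom–Gysin exactness for one smooth closed subvariety (`HodgeTheory/ThomGysinClosedImmersion`:
  `ker (Hᵇ(X(ℂ)) → Hᵇ((X ∖ i(V))(ℂ))) = i_* H^{b−2r}(V(ℂ))`, injective for `b < 2r`; Voisin II §6.1.1, Deligne Hodge III 8.2.8):
  **`ChernDatum.chKZeroCoh_eq_zero_of_lt_codim`** — `ch_k(F) = 0` for `k < r`; **`ChernDatum.exists_chKZeroCoh_eq_smul_complexGysin_one`** —
  `ch_r(F) = c • i_* 1_V` for SOME `c ∈ ℂ` (`H⁰(V(ℂ); ℂ) = ℂ · 1_V`, `V(ℂ)` being path connected); the instances for `F = i_*𝒪_V`.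
* §4 `ChernDatum.complexGysin_one_mem_span_ch_of_chKZeroCoh_ne_zero` — consequently **the Gysin generator `i_* 1_V` of a CLOSED
  IMMERSION lies in `ℂ · {ch_r(E) : E a vector bundle}` as soon as `ch_r(F) ≠ 0` for one coherent `F` supported on `i(V)`**: what
  the span law (`stub_spanForOne` of crux line `grothendieck_axiomatic`, item stmt-HodgeConjecture-19780) still needs for such generators
  is exactly the NON-VANISHING of the leading coefficient (`c = λʳ`, `λ ≠ 0` the scale of a non-degenerate datum, by deformation to the
  normal cone — not here); generators `g_* 1_V` along non-immersions need in addition Riemann–Roch for a projection (Fulton Thm. 15.2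
  for `ℙᵐ × X → X`), not here either.

Everything is proved; no definition, no named fact, no instance, no notation.

## References

* [Fulton1998] W. Fulton, Intersection Theory, 2nd ed. (1998): §15.1 (with App. B.8.3), Thm. 15.2, §15.3 and Example 15.3.1,
  Example 15.2.16 (b), §19.1.
* [VoisinHodgeII2003] C. Voisin, Hodge Theory and Complex Algebraic Geometry II (2003): §6.1.1 (Thom–Gysin sequence).
* [DeligneHodgeIII1974] P. Deligne, Théorie de Hodge III, Publ. Math. IHÉS 44 (1974): Cor. 8.2.8.
* [Hartshorne1977] R. Hartshorne, Algebraic Geometry (1977): III Ex. 6.9, III Prop. 9.2, II Ex. 5.5.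
* [BorelSerre1958] A. Borel, J.-P. Serre, Le théorème de Riemann–Roch, Bull. SMF 86 (1958): §4 Lemme 12, §7.
* Tree: `HodgeTheory/ChernCharacterLawsCoherent`, `HodgeTheory/ThomGysinClosedImmersion`, `HodgeTheory/AffineLineBundleCohomology`
  (`restrictCompl_eq_zero_of_map_eq_zero`), `ModuliOfSheaves/LangerBoundedness` (`isZero_pullback_pushforward_of_disjoint`),
  `Modules/PullbackStalk` (`preservesFiniteLimits_pullback_of_flat`), `KTheory/EulerCharacteristic`.
-/

noncomputable section

open CategoryTheory CategoryTheory.Limits AlgebraicGeometry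
open Literature.AlgebraicTopology.SingularHomology
open Literature.AlgebraicGeometry.Motives Literature.AlgebraicGeometry.Modules Literature.AlgebraicGeometry.Morphisms

/-! ### §1 Flat pull-back kills the class of a sheaf that dies -/

namespace Literature.AlgebraicGeometry.KTheory

universe u

/-- **Along a flat `u : U ⟶ X` with `u^*F = 0`, the class `[F]_{ℰ•} ∈ K₀(X)` of `F` on a finite locally free resolution `ℰ• → F`
pulls back to `0` in `K₀(U)`**: `u^*[F]_{ℰ•} = χ(u^*ℰ•)` (`map_eulerChar`), and `u^*ℰ•` is acyclic — the exact functor `u^*` carries the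
quasi-isomorphism `ℰ• → F[0]` to a quasi-isomorphism `u^*ℰ• → (u^*F)[0] = 0` — so `χ(u^*ℰ•) = 0` (`eulerChar_eq_zero_of_acyclic`).
[cite: Hartshorne1977, III Ex. 6.9 (b) (p. 239) and III Prop. 9.2] [cite: BorelSerre1958, §4 Lemme 12] -/
theorem KZero.map_ofCoh_eq_zero_of_isZero_pullback {U X : Scheme.{u}} (u : U ⟶ X) [Flat u] {F : X.Modules}
    (R : StrictlyPerfectResolution F) (h0 : IsZero ((Scheme.Modules.pullback u).obj F)) :
    KZero.map u (KZero.ofCoh F R) = 0 := by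
  rw [KZero.ofCoh_def, map_eulerChar u R.isBoundedVB]
  refine (R.isBoundedVB.pullback u).eulerChar_eq_zero_of_acyclic ?_
  -- `u^*` is exact, hence preserves homology and quasi-isomorphisms
  haveI : PreservesFiniteLimits (Scheme.Modules.pullback u) := preservesFiniteLimits_pullback_of_flat u
  haveI : (Scheme.Modules.pullback u).PreservesHomology := inferInstance
  haveI := R.quasiIso
  -- the target `u^*(F[0]) ≅ (u^*F)[0]` is a zero object
  have hZ : IsZero (((Scheme.Modules.pullback u).mapHomologicalComplex (ComplexShape.up ℤ)).obj
      ((CochainComplex.singleFunctor X.Modules 0).obj F)) :=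
    (((HomologicalComplex.single U.Modules (ComplexShape.up ℤ) 0).map_isZero h0).of_iso
      ((HomologicalComplex.singleMapHomologicalComplex (Scheme.Modules.pullback u) (ComplexShape.up ℤ) 0).app F))
  intro j
  rw [exactAt_iff_of_quasiIsoAt
    (((Scheme.Modules.pullback u).mapHomologicalComplex (ComplexShape.up ℤ)).map R.ε) j]
  exact ShortComplex.exact_of_isZero_X₂ _ ((HomologicalComplex.eval _ _ j).map_isZero hZ)

end Literature.AlgebraicGeometry.KTheory

namespace Literature.AlgebraicGeometry.HodgeTheory

open Literature.AlgebraicGeometry.KTheory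
open Literature.AlgebraicGeometry.KTheory.Adapted (coh_of_isFiniteLocallyFree)

namespace ChernDatum

section HodgeTheory

variable {n : ℕ} {X : SchemeOver ℂ}

/-! ### §2 `ch_k(F)` dies where `F` dies -/

/-- `i_*𝒪_V` is supported on `i(V)`: its inverse image on an open disjoint from `i(V)` vanishes (its sections there are sections
of `𝒪_V` over `∅`). [cite: Hartshorne1977, II Ex. 1.19 and II §5] -/
theorem isZero_pullback_ι_pushforward_unit_of_disjoint {V : SchemeOver ℂ} (i : V ⟶ X) (W : X.left.Opens)
    (hW : Disjoint (W : Set X.left) (Set.range i.left.base)) :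
    IsZero ((Scheme.Modules.pullback W.ι).obj ((Scheme.Modules.pushforward i.left).obj (unitModule V.left))) :=
  ModuliOfSheaves.isZero_pullback_pushforward_of_disjoint W.ι i.left (by rwa [Scheme.Opens.range_ι]) _

/-- `i_*𝒪_V` is coherent on the smooth projective `X` (closed immersions into locally noetherian schemes have coherent direct
image of the structure sheaf). [cite: Hartshorne1977, II Ex. 5.5] -/
theorem coh_pushforward_unit_of_isSmoothProjective (hX : IsSmoothProjective n X) {V : SchemeOver ℂ} (i : V ⟶ X)
    [IsClosedImmersion i.left] : Coh ((Scheme.Modules.pushforward i.left).obj (unitModule V.left)) := by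
  haveI : IsProper X.hom := hX.isProjectiveOver.isProper
  haveI : IsLocallyNoetherian X.left := LocallyOfFiniteType.isLocallyNoetherian X.hom
  exact coh_pushforward_unit i.left

variable (ch : ChernDatum)
  (hadd : ∀ {X : SchemeOver ℂ} (S : ShortComplex X.left.Modules), S.ShortExact →
    IsVectorBundle S.X₁ → IsVectorBundle S.X₃ → ∀ i : ℕ, ch X S.X₂ i = ch X S.X₁ i + ch X S.X₃ i)
  (hmap : ∀ {X Y : SchemeOver ℂ} (f : Y ⟶ X) (E : X.left.Modules), IsVectorBundle E →
    ∀ i : ℕ, complexBetti.map f (2 * i) (ch X E i) = ch Y ((Scheme.Modules.pullback f.left).obj E) i)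

include hmap

/-- **`u^* ch_k(F) = 0` for a flat `u : U ⟶ X` over `ℂ` with `u^*F = 0`** (`F` coherent on the smooth projective `X`): compute
`ch_k(F)` on a resolution `ℰ•`, move `u^*` inside by functoriality (`map_chKZero`), and use `u^*[F]_{ℰ•} = 0`
(`KZero.map_ofCoh_eq_zero_of_isZero_pullback`). [cite: Fulton1998, §15.1 (ii) with App. B.8.3] [cite: Hartshorne1977, III Ex. 6.9 (b)] -/
theorem map_chKZeroCoh_eq_zero_of_isZero_pullback (hX : IsSmoothProjective n X) {U : SchemeOver ℂ} (u : U ⟶ X) [Flat u.left]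
    {F : X.left.Modules} (hF : Coh F) (h0 : IsZero ((Scheme.Modules.pullback u.left).obj F)) (k : ℕ) :
    complexBetti.map u (2 * k) (chKZeroCoh ch hadd hX k (KZeroCoh.of F hF)) = 0 := by
  obtain ⟨R⟩ := Modules.IsSmoothProjective.nonempty_strictlyPerfectResolution_of_coh hX hF
  rw [chKZeroCoh_of ch hadd hX k hF R, map_chKZero ch hadd hmap u k,
    KZero.map_ofCoh_eq_zero_of_isZero_pullback u.left R h0, map_zero]

/-- **`ch_k(F)` restricts to `0` on `(X ∖ i(V))(ℂ)` when `F` is supported on the image of the closed immersion `i`** (hypothesis: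
the inverse image of `F` on every open disjoint from `i(V)` vanishes): the open complement `X ∖ i(V) ↪ X` is a flat `ℂ`-morphism
whose complex points are `(X ∖ i(V))(ℂ)` (`restrictCompl_eq_zero_of_map_eq_zero`). [cite: Fulton1998, §15.1 (ii)]
[cite: VoisinHodgeII2003, §6.1.1] -/
theorem restrictCompl_chKZeroCoh_eq_zero (hX : IsSmoothProjective n X) {V : SchemeOver ℂ} (i : V ⟶ X) [IsClosedImmersion i.left]
    {F : X.left.Modules} (hF : Coh F)
    (h0 : ∀ W : X.left.Opens, Disjoint (W : Set X.left) (Set.range i.left.base) → IsZero ((Scheme.Modules.pullback W.ι).obj F))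
    (k : ℕ) :
    complexBetti.restrictCompl X (Set.range i.left.base) (2 * k) (chKZeroCoh ch hadd hX k (KZeroCoh.of F hF)) = 0 := by
  -- the open complement `W = X ∖ i(V)` as a scheme over `ℂ`
  let W : X.left.Opens := ⟨(Set.range i.left.base)ᶜ, i.left.isClosedEmbedding.isClosed_range.isOpen_compl⟩
  let U : SchemeOver ℂ := Over.mk (W.ι ≫ X.hom)
  let u : U ⟶ X := Over.homMk W.ι
  have hu : Set.range u.left.base = (Set.range i.left.base)ᶜ := by
    change Set.range W.ι.base = _
    rw [Scheme.Opens.range_ι]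
    rfl
  haveI : IsOpenImmersion u.left := inferInstanceAs (IsOpenImmersion W.ι)
  haveI : Flat u.left := inferInstance
  refine restrictCompl_eq_zero_of_map_eq_zero i u hu (2 * k) _ ?_
  exact map_chKZeroCoh_eq_zero_of_isZero_pullback ch hadd hmap hX u hF
    (h0 W (Set.disjoint_compl_left_iff_subset.2 subset_rfl)) k

/-! ### §3 Thom–Gysin: vanishing below the codimension, and the shape in the codimension -/

/-- **`ch_k(F) = 0` for `k` below the codimension** of the smooth support: for `F` coherent on the smooth projective `X`
(`dim X = n`) supported on `i(V)`, `V` smooth projective of dimension `m`, and `k + m < n`, the class `ch_k(F)` dies on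
`(X ∖ i(V))(ℂ)` and `H²ᵏ(X(ℂ)) → H²ᵏ((X ∖ i(V))(ℂ))` is injective below the codimension (Thom–Gysin).
[cite: VoisinHodgeII2003, §6.1.1 (Thom–Gysin sequence before (6.3))] [cite: Fulton1998, §15.3 Example 15.3.1] -/
theorem chKZeroCoh_eq_zero_of_lt_codim (μ : OrientationFamily) (hX : IsSmoothProjective n X) {m : ℕ} {V : SchemeOver ℂ}
    (hV : IsSmoothProjective m V) (i : V ⟶ X) [IsClosedImmersion i.left] {F : X.left.Modules} (hF : Coh F)
    (h0 : ∀ W : X.left.Opens, Disjoint (W : Set X.left) (Set.range i.left.base) → IsZero ((Scheme.Modules.pullback W.ι).obj F))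
    {k : ℕ} (hk : k + m < n) :
    chKZeroCoh ch hadd hX k (KZeroCoh.of F hF) = 0 := by
  have hker := ker_restrictCompl_eq_bot_of_isClosedImmersion μ hX hV i (b := 2 * k) (by omega)
  have hmem : chKZeroCoh ch hadd hX k (KZeroCoh.of F hF) ∈
      LinearMap.ker (complexBetti.restrictCompl X (Set.range i.left.base) (2 * k)).hom :=
    restrictCompl_chKZeroCoh_eq_zero ch hadd hmap hX i hF h0 k
  rw [hker] at hmem
  exact (Submodule.mem_bot ℂ).1 hmem

/-- **The SHAPE of the leading term**: for `F` coherent on the smooth projective `X` (`dim X = m + r`) supported on `i(V)`, `V` smooth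
projective of dimension `m`, there is `c ∈ ℂ` with **`ch_r(F) = c • i_* 1_V`** — `ch_r(F)` dies on `(X ∖ i(V))(ℂ)`, so it is a Gysin
image `i_* y` with `y ∈ H⁰(V(ℂ); ℂ) = ℂ · 1_V` (Thom–Gysin; `V(ℂ)` path connected). The value `c = λʳ` (Riemann–Roch without
denominators) is not asserted. [cite: VoisinHodgeII2003, §6.1.1] [cite: Fulton1998, Thm. 15.2 and Example 15.3.1]
[cite: DeligneHodgeIII1974, Cor. 8.2.8] -/
theorem exists_chKZeroCoh_eq_smul_complexGysin_one (μ : OrientationFamily) (hX : IsSmoothProjective n X) {m r : ℕ}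
    (hmr : m + r = n) {V : SchemeOver ℂ} (hV : IsSmoothProjective m V) (i : V ⟶ X) [IsClosedImmersion i.left]
    {F : X.left.Modules} (hF : Coh F)
    (h0 : ∀ W : X.left.Opens, Disjoint (W : Set X.left) (Set.range i.left.base) → IsZero ((Scheme.Modules.pullback W.ι).obj F)) :
    ∃ c : ℂ, chKZeroCoh ch hadd hX r (KZeroCoh.of F hF) =
      c • complexGysin μ hV hX i (a := 0) (b := 2 * r) (by omega) (singularCohomology.one ℂ (ComplexPoints V)) := by
  obtain ⟨y, hy⟩ := exists_complexGysin_eq_of_isClosedImmersion μ hX hV i (a := 0) (b := 2 * r) (by omega)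
    (restrictCompl_chKZeroCoh_eq_zero ch hadd hmap hX i hF h0 r)
  haveI := pathConnectedSpace_complexPoints_of_isSmoothProjective hV
  refine ⟨singularCohomologyZeroEquiv ℂ ℂ (ComplexPoints V) y, ?_⟩
  rw [← hy, ← map_smul, ← singularCohomology.eq_smul_one ℂ y]

/-- **`ch_k(i_*𝒪_V) = 0` for `k < codim V`.** [cite: Fulton1998, §15.3 Example 15.3.1] [cite: VoisinHodgeII2003, §6.1.1] -/
theorem chKZeroCoh_pushforward_unit_eq_zero_of_lt_codim (μ : OrientationFamily) (hX : IsSmoothProjective n X) {m : ℕ}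
    {V : SchemeOver ℂ} (hV : IsSmoothProjective m V) (i : V ⟶ X) [IsClosedImmersion i.left]
    (hcoh : Coh ((Scheme.Modules.pushforward i.left).obj (unitModule V.left))) {k : ℕ} (hk : k + m < n) :
    chKZeroCoh ch hadd hX k (KZeroCoh.of _ hcoh) = 0 :=
  chKZeroCoh_eq_zero_of_lt_codim ch hadd hmap μ hX hV i hcoh (isZero_pullback_ι_pushforward_unit_of_disjoint i) hk

/-- **`ch_r(i_*𝒪_V) = c • i_* 1_V` for some `c ∈ ℂ`** (`r = codim V`; the shape of «`c_r(i_*𝒪_V) = (−1)^{r−1}(r−1)! [V]`», whose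
coefficient is not computed here). [cite: Fulton1998, Thm. 15.2 and §15.3 Example 15.3.1] [cite: VoisinHodgeII2003, §6.1.1] -/
theorem exists_chKZeroCoh_pushforward_unit_eq_smul (μ : OrientationFamily) (hX : IsSmoothProjective n X) {m r : ℕ}
    (hmr : m + r = n) {V : SchemeOver ℂ} (hV : IsSmoothProjective m V) (i : V ⟶ X) [IsClosedImmersion i.left]
    (hcoh : Coh ((Scheme.Modules.pushforward i.left).obj (unitModule V.left))) :
    ∃ c : ℂ, chKZeroCoh ch hadd hX r (KZeroCoh.of _ hcoh) =
      c • complexGysin μ hV hX i (a := 0) (b := 2 * r) (by omega) (singularCohomology.one ℂ (ComplexPoints V)) :=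
  exists_chKZeroCoh_eq_smul_complexGysin_one ch hadd hmap μ hX hmr hV i hcoh (isZero_pullback_ι_pushforward_unit_of_disjoint i)

/-! ### §4 What the span law still needs for the Gysin generator of a closed immersion -/

/-- **The Gysin generator `i_* 1_V` of a closed immersion of smooth projective varieties lies in `ℂ · {ch_r(E) : E a vector bundle}`
as soon as `ch_r(F) ≠ 0` for ONE coherent `F` supported on `i(V)`** (`r = codim V`): `ch_r(F) = c • i_* 1_V` with `c ≠ 0`, and
`ch_r(F)` is a `ℂ`-combination of `ch_r` of vector bundles (`chKZeroCoh_mem_span`). The remaining input for such generators of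
`Nʳ H²ʳ` is thus the NON-VANISHING of the leading coefficient (`c = λʳ` for `F = i_*𝒪_V` and a datum of scale `λ ≠ 0`).
[cite: Fulton1998, Thm. 15.2, Example 15.2.16 (b) and Example 15.3.1] [cite: BorelSerre1958, §7] -/
theorem complexGysin_one_mem_span_ch_of_chKZeroCoh_ne_zero (μ : OrientationFamily) (hX : IsSmoothProjective n X) {m r : ℕ}
    (hmr : m + r = n) {V : SchemeOver ℂ} (hV : IsSmoothProjective m V) (i : V ⟶ X) [IsClosedImmersion i.left]
    {F : X.left.Modules} (hF : Coh F)
    (h0 : ∀ W : X.left.Opens, Disjoint (W : Set X.left) (Set.range i.left.base) → IsZero ((Scheme.Modules.pullback W.ι).obj F))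
    (hne : chKZeroCoh ch hadd hX r (KZeroCoh.of F hF) ≠ 0) :
    complexGysin μ hV hX i (a := 0) (b := 2 * r) (by omega) (singularCohomology.one ℂ (ComplexPoints V)) ∈
      Submodule.span ℂ {c | ∃ E : X.left.Modules, IsVectorBundle E ∧ ch X E r = c} := by
  obtain ⟨c, hc⟩ := exists_chKZeroCoh_eq_smul_complexGysin_one ch hadd hmap μ hX hmr hV i hF h0
  have hc0 : c ≠ 0 := by
    rintro rfl
    exact hne (by rw [hc, zero_smul])
  have hmem := chKZeroCoh_mem_span ch hadd hX r (KZeroCoh.of F hF)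
  rw [hc] at hmem
  have h' := Submodule.smul_mem _ c⁻¹ hmem
  rwa [smul_smul, inv_mul_cancel₀ hc0, one_smul] at h'

end HodgeTheory

end ChernDatum

end Literature.AlgebraicGeometry.HodgeTheory

end
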